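import Literature.AlgebraicGeometry.Frobenioids.BaseSectionsOfObjectsUniqueness
import HarnessLib

/-!
# Frobenioids I, Proposition 5.6 WITHOUT "unit-profinite type" — the author's Comments (2024), item (2)

Mochizuki, *The geometry of Frobenioids I: the general theory*, Kyushu J. Math. **62** (2008)
293–400, §5, Proposition 5.6 pp. 105–107 [cite: MochizukiFrdI2008, Prop. 5.6 p.105], and the author's
*Comments on "The geometry of Frobenioids I"* (January 2024), item (2), read verbatim on the cell render
`lit/comments/FrdI-Comments-2024.txt`: "The hypothesis that the Frobenioids under consideration be of
'unit-profinite type' in Proposition 5.6 — hence also in Corollary 5.7, (iii) — may be removed. Indeed, if,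
in the notation of the proof of Proposition 5.6, one writes `φ'_p = c_p · φ_p`, where `c_p ∈ O^×(A)`, for
`p ∈ Primes`, then one has `c_2 · c_p^2 · φ_2 · φ_p = … = c_p · c_2^p · φ_2 · φ_p` — so `c_2 · c_p^2 = c_p · c_2^p`,
i.e., `c_p = c_2^{p-1}`, for `p ∈ Primes`. Thus, `φ'_p = c_2^{-1} · φ_p · c_2`, so by taking `u := c_2^{-1}`,
one may eliminate the final two paragraphs of the proof of Proposition 5.6."

PROOF-ONLY file (seat abc-iut-L1-t12, the Prop. 5.6 discharger of record `prop56_holds`,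
`BaseSectionsOfObjectsUniqueness.lean`; prompted by abc-iut-L6-d7's second-reading note 2026-08-26T05:16Z
that the unit-profinite hypothesis is idle in that proof).  The landed proof already establishes the
cocycle `c_{l₁}^{l₂-1} = c_{l₂}^{l₁-1}` for all primes `l₁, l₂` in the commutative group `O^×(A)` (its
Step 2) and then extracts `u₀` with `u₀^{l-1} = c_l` from the PROFINITE topology (Step 3,
`IsTfgProfinite.exists_pow_pred_eq`).  Exactly as in the Comment, the case `l₁ = 2` of the cocycle reads
`c_2^{l-1} = c_l`, so `u₀ := c_2` works in ANY commutative group and no topology is needed: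

* `basePairs_conjugate_of_isFrobeniusNormalized` — two base-Frobenius pairs restricted to a common object
  `A` are conjugate AS PAIRS by a unit, for any Frobenioid of Frobenius-normalized type (no unit-profinite,
  no isotropy, no pre-model hypothesis);
* `prop56_without_unitProfinite` — the typed statement `Prop56 F B` with the antecedent
  `IsOfUnitProfiniteType F` DELETED (the 2024 form); `prop56_of_prop44_without_unitProfinite` — the same
  from the printed "model type" via Prop. 4.4 (i)(ii) (`isFrobeniusNormalized_of_birat`).

The typed 2008 statement `Prop56 F B` (with the hypothesis) is the special case — already landed as
`prop56_holds` (not re-proved here: the gate identifies a second proof of the same statement with it).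
No new definitions; nothing here is specific to the abc programme.
-/

namespace Literature.AlgebraicGeometry.Frobenioids

open CategoryTheory

universe w v v' u u'

namespace PreFrobenioid

variable {D : Type u} [Category.{v} D] {Φ : Dᵒᵖ ⥤ CommMonCat.{w}}
  {C : Type u'} [Category.{v'} C] (F : C ⥤ ElemFrobenioid Φ)

/-- **[FrdI] Prop. 5.6 in the generality of the author's Comments (2024), item (2): NO unit-profinite
hypothesis.**  For a Frobenioid `C` of Frobenius-normalized type, two base-Frobenius pairs `(P, F)`,
`(P', F')` and an object `A` in both `P` and `P'`, the restricted pairs `(σ, φ)`, `(σ', φ')` at `A` are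
conjugate, as pairs, by a unit `u ∈ O^×(A)`: with `φ'_p = c_p · φ_p`, Frobenius-normalization and the
commutativity of `O^×(A)` give `c_p = c_2^{p-1}`, so `u := c_2^{-1}` conjugates `φ` into `φ'` at every prime,
hence on `ℕ_{≥1}`; the section part follows at `p = 2` as in the printed proof (`v_α^2 = v_α ⇒ v_α = 1`).
[cite: MochizukiFrdI2008, Prop. 5.6 p.105] -/
theorem basePairs_conjugate_of_isFrobeniusNormalized (hF : IsFrobenioid F)
    (hnorm : IsOfType (IsFrobeniusNormalized F)) {P : Presection C} {Fr : ℕ+ →* End P.ι}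
    {P' : Presection C} {Fr' : ℕ+ →* End P'.ι} (hP : IsBaseFrobeniusPair F P Fr)
    (hP' : IsBaseFrobeniusPair F P' Fr') {A : C} {σ σ' : Aut (baseObj F A) →* Aut A}
    {φ φ' : ℕ+ →* End A} (hr : IsRestrictedPair F P Fr A σ φ)
    (hr' : IsRestrictedPair F P' Fr' A σ' φ') :
    ∃ u ∈ unitsSubgroup F A, PairConjugate F u σ σ' φ φ' := by
  classical
  have hepi : ∀ {X Y : C} (f : X ⟶ Y), Epi f := fun f => hF.isPreFrobenioid.isTotallyEpimorphic.epi f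
  -- Step 1: the units `v n` (= `c_n` of the Comment) with `φ' n = φ n ≫ v n`
  have hv : ∀ n : ℕ+, ∃ v ∈ unitsSubgroup F A, End.asHom (φ' n) = End.asHom (φ n) ≫ v.hom :=
    fun n => exists_unit_comp_eq F hF (hr.frobenius hP n).2.2 (hr'.frobenius hP' n).2.2
      (hr.frobenius hP n).2.1 (hr'.frobenius hP' n).2.1
      ((hr.frobenius hP n).1.trans (hr'.frobenius hP' n).1.symm)
  choose v hvmem hv using hv
  -- Frobenius-normalization: `w ≫ φ n = φ n ≫ w^n` for units `w`
  have hnφ : ∀ (n : ℕ+) {w : Aut A}, w ∈ unitsSubgroup F A →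
      w.hom ≫ End.asHom (φ n) = End.asHom (φ n) ≫ (w ^ ((n : ℕ+) : ℕ)).hom := by
    intro n w hw
    have := unit_comp_eq_comp_pow F (hnorm A) (hr.frobenius hP n).2.1 hw
    rwa [(hr.frobenius hP n).1] at this
  -- `φ`, `φ'` take commuting values
  have hcomm : ∀ (ψ : ℕ+ →* End A) (m n : ℕ+),
      End.asHom (ψ m) ≫ End.asHom (ψ n) = End.asHom (ψ n) ≫ End.asHom (ψ m) := by
    intro ψ m n
    have h1 : End.asHom (ψ (n * m)) = End.asHom (ψ m) ≫ End.asHom (ψ n) := by rw [map_mul]; rfl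
    have h2 : End.asHom (ψ (m * n)) = End.asHom (ψ n) ≫ End.asHom (ψ m) := by rw [map_mul]; rfl
    rw [← h1, ← h2, mul_comm]
  -- Step 2: the cocycle `v l₁ ^ (l₂ - 1) = v l₂ ^ (l₁ - 1)` in the commutative group `O^×(A)`
  letI : CommGroup (unitsSubgroup F A) := unitsCommGroup F hF A
  let vv : Nat.Primes → unitsSubgroup F A := fun l => ⟨v l, hvmem l⟩
  have hcocycle : ∀ l₁ l₂ : Nat.Primes,
      vv l₁ ^ ((l₂ : ℕ) - 1) = vv l₂ ^ ((l₁ : ℕ) - 1) := by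
    intro l₁ l₂
    have key : (v l₁ ^ ((l₂ : ℕ+) : ℕ)).hom ≫ (v l₂).hom =
        (v l₂ ^ ((l₁ : ℕ+) : ℕ)).hom ≫ (v l₁).hom := by
      have e := hcomm φ' l₁ l₂
      rw [hv l₁, hv l₂, Category.assoc, Category.assoc, reassoc_of% (hnφ l₂ (hvmem l₁)),
        reassoc_of% (hnφ l₁ (hvmem l₂)), reassoc_of% (hcomm φ l₂ l₁)] at e
      exact (cancel_epi _).mp ((cancel_epi _).mp e)
    have key' : v l₂ * v l₁ ^ ((l₂ : ℕ+) : ℕ) = v l₁ * v l₂ ^ ((l₁ : ℕ+) : ℕ) := by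
      ext
      rw [Aut.Aut_mul_def, Aut.Aut_mul_def, Iso.trans_hom, Iso.trans_hom]
      exact key
    have key'' : vv l₂ * vv l₁ ^ ((l₂ : ℕ+) : ℕ) = vv l₁ * vv l₂ ^ ((l₁ : ℕ+) : ℕ) :=
      Subtype.ext key'
    have h₁ : ((l₂ : ℕ+) : ℕ) = ((l₂ : ℕ) - 1) + 1 := (Nat.sub_add_cancel l₂.2.one_lt.le).symm
    have h₂ : ((l₁ : ℕ+) : ℕ) = ((l₁ : ℕ) - 1) + 1 := (Nat.sub_add_cancel l₁.2.one_lt.le).symm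
    rw [h₁, h₂, pow_succ, pow_succ] at key''
    have : vv l₁ * vv l₂ * vv l₁ ^ ((l₂ : ℕ) - 1) = vv l₁ * vv l₂ * vv l₂ ^ ((l₁ : ℕ) - 1) := by
      calc vv l₁ * vv l₂ * vv l₁ ^ ((l₂ : ℕ) - 1)
          = vv l₂ * (vv l₁ ^ ((l₂ : ℕ) - 1) * vv l₁) := by
            rw [mul_comm (vv l₁) (vv l₂), mul_assoc, mul_comm (vv l₁)]
        _ = vv l₁ * (vv l₂ ^ ((l₁ : ℕ) - 1) * vv l₂) := key''
        _ = vv l₁ * vv l₂ * vv l₂ ^ ((l₁ : ℕ) - 1) := by rw [mul_assoc, mul_comm (vv l₂ ^ _)]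
    exact mul_left_cancel this
  -- Step 3 (Comments (2024) item (2)): `u₀ := c_2` satisfies `u₀ ^ (l - 1) = c_l` — the case `l₁ = 2`
  -- of the cocycle; NO topology on `O^×(A)` is used.  Then `u := u₀⁻¹`.
  let u₀ : unitsSubgroup F A := vv ⟨2, Nat.prime_two⟩
  have hu₀ : ∀ l : Nat.Primes, u₀ ^ ((l : ℕ) - 1) = vv l := fun l => by
    have h := hcocycle ⟨2, Nat.prime_two⟩ l
    have h2 : (((⟨2, Nat.prime_two⟩ : Nat.Primes) : ℕ) - 1) = 1 := rfl
    rw [h2, pow_one] at h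
    exact h
  set uA : Aut A := ((u₀⁻¹ : unitsSubgroup F A) : Aut A) with huA
  have huAmem : uA ∈ unitsSubgroup F A := (u₀⁻¹).2
  have huAinv : uA.inv = (u₀ : Aut A).hom := by
    rw [huA, Subgroup.coe_inv, Aut.Aut_inv_def, Iso.symm_inv]
  have huAhom : uA.hom = (u₀ : Aut A).inv := by
    rw [huA, Subgroup.coe_inv, Aut.Aut_inv_def, Iso.symm_hom]
  -- conjugation of `φ` at primes …
  have hprime : ∀ l : Nat.Primes,
      End.asHom (φ' l) = uA.inv ≫ End.asHom (φ l) ≫ uA.hom := by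
    intro l
    have hU : ((vv l : unitsSubgroup F A) : Aut A) = (u₀ : Aut A) ^ ((l : ℕ) - 1) := by
      rw [← hu₀ l, Subgroup.coe_pow]
    have hl1 : ((l : ℕ+) : ℕ) = ((l : ℕ) - 1) + 1 := (Nat.sub_add_cancel l.2.one_lt.le).symm
    have e1 : v (l : ℕ+) = (u₀ : Aut A)⁻¹ * (u₀ : Aut A) ^ ((l : ℕ+) : ℕ) := by
      rw [hl1, pow_succ', inv_mul_cancel_left, ← hU]
    have hvl : (v l).hom = ((u₀ : Aut A) ^ ((l : ℕ+) : ℕ)).hom ≫ (u₀ : Aut A).inv := by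
      have e2 := congrArg Iso.hom e1
      rw [Aut.Aut_mul_def, Iso.trans_hom, Aut.Aut_inv_def, Iso.symm_hom] at e2
      exact e2
    rw [hv l, hvl, huAinv, huAhom, ← Category.assoc (u₀ : Aut A).hom, hnφ l u₀.2, Category.assoc]
  -- … hence for all `n`
  let c : End A →* End A :=
    { toFun := fun x => End.of (uA.inv ≫ End.asHom x ≫ uA.hom)
      map_one' := by simp [End.one_def]
      map_mul' := fun x y => by simp [End.mul_def] }
  have hall : ∀ n : ℕ+, End.asHom (φ' n) = uA.inv ≫ End.asHom (φ n) ≫ uA.hom := by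
    have heq : φ' = c.comp φ := pnat_monoidHom_ext fun p => hprime p
    intro n
    exact congrArg (fun ψ : ℕ+ →* End A => End.asHom (ψ n)) heq
  refine ⟨uA, huAmem, fun α => ?_, fun n => hall n⟩
  -- Step 4: the section part `σ' α = uA.symm ≪≫ σ α ≪≫ uA`
  set τ : Aut A := uA.symm ≪≫ σ α ≪≫ uA with hτ
  set vα : Aut A := τ.symm ≪≫ σ' α with hvαdef
  have hσ' : σ' α = τ ≪≫ vα := by rw [hvαdef, Iso.self_symm_id_assoc]
  have hbu : Base F uA.hom = 𝟙 _ := huAmem.1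
  have hbui : Base F uA.inv = 𝟙 _ := by
    have := ((unitsSubgroup F A).inv_mem huAmem).1
    rwa [Aut.Aut_inv_def] at this
  have hbσ : Base F (σ α).inv = α.inv := congrArg Iso.inv (hr.base_σ α)
  have hbσ' : Base F (σ' α).hom = α.hom := congrArg Iso.hom (hr'.base_σ α)
  have hvα : vα ∈ unitsSubgroup F A := by
    refine ⟨?_, isLinear_of_isIso F _⟩
    show Base F (τ.inv ≫ (σ' α).hom) = 𝟙 _
    rw [hτ]
    simp only [Iso.trans_inv, Iso.symm_inv, base_comp, hbu, hbui, hbσ, hbσ', Category.assoc,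
      Category.id_comp, Category.comp_id, Iso.inv_hom_id]
  have e := hr'.comm 2 α
  have hs' : (σ' α).hom = uA.inv ≫ (σ α).hom ≫ uA.hom ≫ vα.hom := by
    rw [hσ', Iso.trans_hom, hτ, Iso.trans_hom, Iso.trans_hom, Iso.symm_hom, Category.assoc,
      Category.assoc]
  rw [hs', hall 2] at e
  simp only [Category.assoc] at e
  have hcw : uA.hom ≫ vα.hom = vα.hom ≫ uA.hom := units_hom_comm F hF huAmem hvα
  rw [reassoc_of% hcw, hcw, Iso.hom_inv_id_assoc, Iso.hom_inv_id_assoc,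
    reassoc_of% (hnφ 2 hvα), reassoc_of% (hr.comm 2 α)] at e
  have e3 : (vα ^ ((2 : ℕ+) : ℕ)).hom = vα.hom :=
    (cancel_mono uA.hom).mp ((cancel_epi (σ α).hom).mp
      ((cancel_epi (End.asHom (φ 2))).mp ((cancel_epi uA.inv).mp e)))
  have hsq : vα ^ ((2 : ℕ+) : ℕ) = vα := Iso.ext e3
  have hv1 : vα = 1 := by
    have : vα * vα = vα * 1 := by rw [mul_one, ← pow_two]; exact hsq
    exact mul_left_cancel this
  rw [hσ', hv1]
  exact Iso.trans_refl _

variable (B : (PreFrobenioidData.ofFunctor Φ F).BiratData)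

/-- **Proposition 5.6 in its 2024 form** (Comments item (2): "the hypothesis … 'unit-profinite type' … may
be removed"): the typed statement `Prop56 F B` with the antecedent `IsOfUnitProfiniteType F` deleted and
every other binder unchanged. [cite: MochizukiFrdI2008, Prop. 5.6 p.105] -/
theorem prop56_without_unitProfinite :
    IsFrobenioid F → IsOfPreModelType F → PreFrobenioidData.IsOfBiratFrobeniusNormalizedType B →
      IsOfType (IsFrobeniusNormalized F) → IsOfIsotropicType F →
      ∀ (P : Presection C) (Fr : ℕ+ →* End P.ι) (P' : Presection C) (Fr' : ℕ+ →* End P'.ι),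
        IsBaseFrobeniusPair F P Fr → IsBaseFrobeniusPair F P' Fr' →
        ∀ (A : C), IsFrobeniusTrivial F A →
          ∀ (σ σ' : Aut (baseObj F A) →* Aut A) (φ φ' : ℕ+ →* End A),
            IsRestrictedPair F P Fr A σ φ → IsRestrictedPair F P' Fr' A σ' φ' →
              ∃ u ∈ unitsSubgroup F A, PairConjugate F u σ σ' φ φ' := by
  intro hF _ _ hnorm _ P Fr P' Fr' hP hP' A _ σ σ' φ φ' hr hr'
  exact basePairs_conjugate_of_isFrobeniusNormalized F hF hnorm hP hP' hr hr'

/-- The 2024 form from the PRINTED hypothesis "of model type" alone, for a birationalization datum that IS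
the birationalization to the extent of Prop. 4.4 (i), (ii) (`Prop44i B ∧ Prop44ii B` ⇒ birationally
Frobenius-normalized ⇒ Frobenius-normalized, `isFrobeniusNormalized_of_birat`); again no unit-profinite
hypothesis. [cite: MochizukiFrdI2008, Prop. 5.6 p.105] -/
theorem prop56_of_prop44_without_unitProfinite (h44i : PreFrobenioidData.Prop44i B)
    (h44ii : PreFrobenioidData.Prop44ii B) :
    IsFrobenioid F → IsOfPreModelType F → PreFrobenioidData.IsOfBiratFrobeniusNormalizedType B →
      IsOfIsotropicType F →
      ∀ (P : Presection C) (Fr : ℕ+ →* End P.ι) (P' : Presection C) (Fr' : ℕ+ →* End P'.ι),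
        IsBaseFrobeniusPair F P Fr → IsBaseFrobeniusPair F P' Fr' →
        ∀ (A : C), IsFrobeniusTrivial F A →
          ∀ (σ σ' : Aut (baseObj F A) →* Aut A) (φ φ' : ℕ+ →* End A),
            IsRestrictedPair F P Fr A σ φ → IsRestrictedPair F P' Fr' A σ' φ' →
              ∃ u ∈ unitsSubgroup F A, PairConjugate F u σ σ' φ φ' := by
  intro hF _ hB _ P Fr P' Fr' hP hP' A _ σ σ' φ φ' hr hr'
  exact basePairs_conjugate_of_isFrobeniusNormalized F hF (isFrobeniusNormalized_of_birat F B h44i h44ii hB)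
    hP hP' hr hr'

end PreFrobenioid

end Literature.AlgebraicGeometry.Frobenioids
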